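import Summits.QuantumFields.QCD.Theses.EulerDescent

/-!
# Crux `RayDescent` (stmt-QuantumFields-16900), negative side — corner and pin are load-bearing

Disprover record (route `EulerDescent`, sub-problem QCD; cdisprove seat, cycle 1). Two
kernel-checked facts about the hypotheses of
`Summit.QuantumFields.QCD.Theses.EulerDescent.RayDescent`:

* `rayDescent_false_without_pin` — delete ONLY the pin `(m_crit − mc)·Z_m/a → 0` from the crux
  (corner, mass scaling, asymptotic scaling and the Lüscher branch `m_crit > −1` kept verbatim): the
  resulting statement is FALSE as soon as one regularisation `reg` is given which (i) has an
  intrinsic corner sequence, mass scaling and asymptotic scaling, (ii) has `m_crit(k) → 0` and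
  bare-mass resolution `a_k/Z_m(k) → 0`, (iii) is chirally soft ALONG THE DIAGONAL NEAR ZERO (for every
  rate `ε > 0` and every `δ > 0` some degenerate tuple `(μ,…,μ)`, `0 < μ < δ`, has no uniform lattice
  gap `ε`), and (iv) has ONE gapped degenerate tuple `(μ₀,…,μ₀)`, `μ₀ > 0`, at a rate `Δ₀ > 0`.
  Mechanism: the flavour-blind shift `m_crit ↦ m_crit − a M₀/Z_m` (`M₀ := μ₀ − 2μ₁ > 0`, `μ₁ < μ₀/2`
  a soft point at rate `Δ₀/4`) keeps every remaining hypothesis (the corner set reads only `β`;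
  the scalings read only `a, β, Z_m`; the branch survives because the shift is `o(1)` in lattice
  units), maps the tuple `2·(μ₀ − μ₁)` of the shifted regularisation onto the gapped tuple `μ₀` of
  `reg` and the tuple `μ₀ − μ₁` onto the soft tuple `μ₁`; descent with `l = 2` would certify the
  rate `Δ₀/4 < Δ₀/2` at the soft tuple.
* `rayDescent_false_without_corner` — delete ONLY the corner clause (pin kept): the candidate
  corner `mc` then occurs only in the pin, which `mc := m_crit` discharges, and the same shift
  refutes the statement from (ii)–(iv) alone.

Reading for provers: corner and pin act only JOINTLY; mass scaling, asymptotic scaling and the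
Lüscher branch do not locate the chiral point (they are invariant under `m_crit ↦ m_crit − a M₀/Z_m`,
`M₀ > 0` fixed), so any proof of the crux must use the pin to the INTRINSIC corner essentially — as
the birth skeleton's `stub_repinInvariance` and the picked line `Sketch` do. The witness (i)–(iv) is
the standard picture of `N_f = 2, 3` Wilson lattice QCD (Goldstone softness at the chiral point, a
massive point at positive quark mass); it is not constructible in the present tree (clause (iv) is an
eventual volume-uniform lattice gap of honest lattice QCD), so both theorems carry the witness data
as hypotheses. Def-free theorem file; helpers `hasLatticeMassGap_congr` (the gap clause reads only
`a, β, L, m_f(k)`), `hasLatticeMassGap_repin_of_mq_eq` / `hasLatticeMassGap_of_repin_of_mq_eq`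
(transport between a regularisation and a re-pinned copy along equal bare trajectories),
`eventually_branch_shift`. [folklore]
-/

noncomputable section

open Filter Topology
open Literature.MathematicalPhysics.QuantumFieldTheory

namespace Summit.QuantumFields.QCD.Theorems.RayDescentNegative

/-- **Gap transport between schemes with the same lattice data**: `HasLatticeMassGap` reads only
`a, β, L` and the bare masses `m_f(k)`, so it passes between two schemes agreeing on these
pointwise. [folklore] -/
theorem hasLatticeMassGap_congr {Nf : ℕ} {s₁ s₂ : QCDScheme Nf} (ha : ∀ k, s₁.a k = s₂.a k)
    (hβ : ∀ k, s₁.β k = s₂.β k) (hL : ∀ k, s₁.L k = s₂.L k) (hmq : ∀ f k, s₁.mq f k = s₂.mq f k)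
    {Δ : ℝ} (h : s₁.HasLatticeMassGap Δ) : s₂.HasLatticeMassGap Δ := by
  intro R R' A B
  obtain ⟨C, hC⟩ := h R R' A B
  refine ⟨C, ?_⟩
  filter_upwards [hC] with k hk S hS n hn
  have h1 := hk S (by rw [hL]; exact hS) n hn
  have e1 : (fun fl => s₁.mq fl k) = fun fl => s₂.mq fl k := funext fun fl => hmq fl k
  rw [e1, hβ k, ha k] at h1
  exact h1

/-- **Transport to a re-pinned copy along equal bare trajectories**: if the bare masses of `reg` at
the tuple `m₁` coincide with those of `{reg with mcrit := g}` at the tuple `m₂`, the two schemes are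
the same lattice theories (`a, β, L` are shared), so a uniform gap passes from the first to the
second. The symmetry `m_crit ↦ m_crit − a M/Z_m`, `m ↦ m + M` behind `qcdOf_iff_threshold`, which
only the pin to the intrinsic corner breaks. [folklore] -/
theorem hasLatticeMassGap_repin_of_mq_eq {Nf : ℕ} (reg : QCDRegularisation Nf) (g : ℕ → ℝ)
    (m₁ m₂ : Fin Nf → ℝ)
    (hmq : ∀ f k, reg.mcrit k + reg.a k * m₁ f / reg.Zm k = g k + reg.a k * m₂ f / reg.Zm k)
    {Δ : ℝ} (h : (reg.scheme m₁ 0 0).HasLatticeMassGap Δ) :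
    (({ reg with mcrit := g } : QCDRegularisation Nf).scheme m₂ 0 0).HasLatticeMassGap Δ :=
  hasLatticeMassGap_congr (s₁ := reg.scheme m₁ 0 0)
    (s₂ := ({ reg with mcrit := g } : QCDRegularisation Nf).scheme m₂ 0 0)
    (fun _ => rfl) (fun _ => rfl) (fun _ => rfl) (fun f k => hmq f k) h

/-- The converse transport (from the re-pinned copy back to `reg`). [folklore] -/
theorem hasLatticeMassGap_of_repin_of_mq_eq {Nf : ℕ} (reg : QCDRegularisation Nf) (g : ℕ → ℝ)
    (m₁ m₂ : Fin Nf → ℝ)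
    (hmq : ∀ f k, g k + reg.a k * m₂ f / reg.Zm k = reg.mcrit k + reg.a k * m₁ f / reg.Zm k)
    {Δ : ℝ}
    (h : (({ reg with mcrit := g } : QCDRegularisation Nf).scheme m₂ 0 0).HasLatticeMassGap Δ) :
    (reg.scheme m₁ 0 0).HasLatticeMassGap Δ :=
  hasLatticeMassGap_congr (s₂ := reg.scheme m₁ 0 0)
    (s₁ := ({ reg with mcrit := g } : QCDRegularisation Nf).scheme m₂ 0 0)
    (fun _ => rfl) (fun _ => rfl) (fun _ => rfl) (fun f k => hmq f k) h

/-- A shift of the critical mass by `a_k M / Z_m(k)` is `o(1)` in lattice units, so the Lüscher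
branch `m_crit > −1` survives it when `m_crit(k) → 0` and `a_k / Z_m(k) → 0`. [folklore] -/
theorem eventually_branch_shift {Nf : ℕ} (reg : QCDRegularisation Nf)
    (hcrit : Tendsto reg.mcrit atTop (𝓝 0))
    (hres : Tendsto (fun k => reg.a k / reg.Zm k) atTop (𝓝 0)) (M : ℝ) :
    ∀ᶠ k in atTop, (-1 : ℝ) < reg.mcrit k - reg.a k * M / reg.Zm k := by
  have ht : Tendsto (fun k => reg.mcrit k - reg.a k / reg.Zm k * M) atTop (𝓝 (0 - 0 * M)) :=
    hcrit.sub (hres.mul_const M)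
  rw [zero_mul, sub_zero] at ht
  have hev := ht.eventually (eventually_gt_nhds (by norm_num : (-1 : ℝ) < 0))
  filter_upwards [hev] with k hk
  have e : reg.mcrit k - reg.a k * M / reg.Zm k = reg.mcrit k - reg.a k / reg.Zm k * M := by ring
  rw [e]
  exact hk

/-- **The pin is load-bearing.** `RayDescent` with the pin hypothesis
`(m_crit − mc)·Z_m/a → 0` DELETED (corner, mass scaling, asymptotic scaling, Lüscher branch kept
verbatim) is false, given one regularisation with an intrinsic corner sequence `mc`, mass and
asymptotic scaling, `m_crit → 0`, `a/Z_m → 0`, diagonal chiral softness near zero and one gapped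
degenerate tuple (the standard picture of `N_f = 2, 3` Wilson lattice QCD; hypotheses here, not
constructed). Witness: the re-pinned regularisation `m_crit ↦ m_crit − a M₀/Z_m`, `M₀ = μ₀ − 2μ₁`
(`μ₁ < μ₀/2` a soft point at rate `Δ₀/4`), the SAME corner sequence `mc`, tuple `m = (μ₀ − μ₁,…)`,
`l = 2`, `Δ = Δ₀`, `Δ' = Δ₀/4`. [folklore] -/
theorem rayDescent_false_without_pin
    {Nf : ℕ} (reg : QCDRegularisation Nf) (mc : ℕ → ℝ)
    (hcorner : ∀ᶠ k in atTop, IsLUB {μ : ℝ | ¬ (∀ (R R' : ℕ) (A : QCDLatticeObservable Nf R)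
        (B : QCDLatticeObservable Nf R'), ∃ (C δ : ℝ) (S₀ : ℕ), 0 < δ ∧ ∀ S : ℕ, S₀ ≤ S →
          ∀ n : ℕ, n ≤ S → ‖qcdLatticeConnectedCorr (reg.β k) (2 * S + 1) (fun _ : Fin Nf => μ)
            A B n‖ ≤ C * Real.exp (-(δ * n)))} (mc k))
    (hms : reg.HasMassScaling) (haf : (reg.scheme 0 0 0).HasAsymptoticScaling)
    (hcrit : Tendsto reg.mcrit atTop (𝓝 0))
    (hres : Tendsto (fun k => reg.a k / reg.Zm k) atTop (𝓝 0))
    (hsoft : ∀ ε : ℝ, 0 < ε → ∀ δ : ℝ, 0 < δ → ∃ μ : ℝ, 0 < μ ∧ μ < δ ∧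
      ¬ (reg.scheme (fun _ : Fin Nf => μ) 0 0).HasLatticeMassGap ε)
    {μ₀ Δ₀ : ℝ} (hμ₀ : 0 < μ₀) (hΔ₀ : 0 < Δ₀)
    (hgap : (reg.scheme (fun _ : Fin Nf => μ₀) 0 0).HasLatticeMassGap Δ₀) :
    ¬ (∀ (Nf : ℕ) (reg : QCDRegularisation Nf) (mc : ℕ → ℝ),
        (∀ᶠ k in atTop, IsLUB {μ : ℝ | ¬ (∀ (R R' : ℕ) (A : QCDLatticeObservable Nf R)
            (B : QCDLatticeObservable Nf R'), ∃ (C δ : ℝ) (S₀ : ℕ), 0 < δ ∧ ∀ S : ℕ, S₀ ≤ S →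
              ∀ n : ℕ, n ≤ S → ‖qcdLatticeConnectedCorr (reg.β k) (2 * S + 1)
                (fun _ : Fin Nf => μ) A B n‖ ≤ C * Real.exp (-(δ * n)))} (mc k)) →
        reg.HasMassScaling → (reg.scheme 0 0 0).HasAsymptoticScaling →
        (∀ᶠ k in atTop, (-1 : ℝ) < reg.mcrit k) →
        ∀ m : Fin Nf → ℝ, (∀ f, 0 < m f) → ∀ l : ℝ, 1 ≤ l → ∀ Δ : ℝ, 0 < Δ →
          (reg.scheme (fun f => l * m f) 0 0).HasLatticeMassGap Δ →
          ∀ Δ' : ℝ, 0 < Δ' → Δ' < Δ / l → (reg.scheme m 0 0).HasLatticeMassGap Δ') := by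
  intro hD
  -- a soft degenerate point `μ₁ < μ₀ / 2` at rate `Δ₀ / 4`
  obtain ⟨μ₁, hμ₁, hμ₁lt, hnogap⟩ := hsoft (Δ₀ / 4) (by positivity) (μ₀ / 2) (by positivity)
  -- the shifted critical mass (kept opaque) and the re-pinned regularisation `{reg with mcrit := g}`
  obtain ⟨g, hg⟩ : ∃ g : ℕ → ℝ, ∀ k, g k = reg.mcrit k - reg.a k * (μ₀ - 2 * μ₁) / reg.Zm k :=
    ⟨_, fun _ => rfl⟩
  have hcorner₁ : ∀ᶠ k in atTop, IsLUB {μ : ℝ | ¬ (∀ (R R' : ℕ) (A : QCDLatticeObservable Nf R)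
      (B : QCDLatticeObservable Nf R'), ∃ (C δ : ℝ) (S₀ : ℕ), 0 < δ ∧ ∀ S : ℕ, S₀ ≤ S →
        ∀ n : ℕ, n ≤ S → ‖qcdLatticeConnectedCorr
          (({ reg with mcrit := g } : QCDRegularisation Nf).β k) (2 * S + 1)
            (fun _ : Fin Nf => μ) A B n‖ ≤ C * Real.exp (-(δ * n)))} (mc k) := hcorner
  have hms₁ : ({ reg with mcrit := g } : QCDRegularisation Nf).HasMassScaling := hms
  have haf₁ :
      (({ reg with mcrit := g } : QCDRegularisation Nf).scheme 0 0 0).HasAsymptoticScaling := haf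
  have hbranch₁ : ∀ᶠ k in atTop,
      (-1 : ℝ) < ({ reg with mcrit := g } : QCDRegularisation Nf).mcrit k := by
    filter_upwards [eventually_branch_shift reg hcrit hres (μ₀ - 2 * μ₁)] with k hk
    show (-1 : ℝ) < g k
    rw [hg k]
    exact hk
  -- the tuple `μ₀ − μ₁`, scale `l = 2`: its double is the gapped tuple `μ₀` of `reg`
  have hmpos : ∀ _f : Fin Nf, (0 : ℝ) < μ₀ - μ₁ := fun _ => by linarith
  have hup : (({ reg with mcrit := g } : QCDRegularisation Nf).scheme
      (fun f : Fin Nf => (2 : ℝ) * (fun _ : Fin Nf => μ₀ - μ₁) f) 0 0).HasLatticeMassGap Δ₀ := by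
    refine hasLatticeMassGap_repin_of_mq_eq reg g (fun _ => μ₀) _ (fun f k => ?_) hgap
    rw [hg k]
    ring
  have hdown := hD Nf ({ reg with mcrit := g } : QCDRegularisation Nf) mc hcorner₁ hms₁ haf₁
    hbranch₁ (fun _ => μ₀ - μ₁) hmpos 2 (by norm_num) Δ₀ hΔ₀ hup (Δ₀ / 4) (by positivity)
    (by linarith)
  -- … and the tuple itself is the soft tuple `μ₁` of `reg`
  refine hnogap (hasLatticeMassGap_of_repin_of_mq_eq reg g (fun _ => μ₁) (fun _ => μ₀ - μ₁)
    (fun f k => ?_) hdown)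
  rw [hg k]
  ring

/-- **The corner is load-bearing.** `RayDescent` with the corner clause DELETED (pin, mass
scaling, asymptotic scaling, Lüscher branch kept verbatim) is false, given one regularisation with
mass and asymptotic scaling, `m_crit → 0`, `a/Z_m → 0`, diagonal chiral softness near zero and one
gapped degenerate tuple: the candidate corner `mc` then occurs only in the pin, which
`mc := m_crit` discharges trivially, and the shift of `rayDescent_false_without_pin` applies.
[folklore] -/
theorem rayDescent_false_without_corner
    {Nf : ℕ} (reg : QCDRegularisation Nf)
    (hms : reg.HasMassScaling) (haf : (reg.scheme 0 0 0).HasAsymptoticScaling)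
    (hcrit : Tendsto reg.mcrit atTop (𝓝 0))
    (hres : Tendsto (fun k => reg.a k / reg.Zm k) atTop (𝓝 0))
    (hsoft : ∀ ε : ℝ, 0 < ε → ∀ δ : ℝ, 0 < δ → ∃ μ : ℝ, 0 < μ ∧ μ < δ ∧
      ¬ (reg.scheme (fun _ : Fin Nf => μ) 0 0).HasLatticeMassGap ε)
    {μ₀ Δ₀ : ℝ} (hμ₀ : 0 < μ₀) (hΔ₀ : 0 < Δ₀)
    (hgap : (reg.scheme (fun _ : Fin Nf => μ₀) 0 0).HasLatticeMassGap Δ₀) :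
    ¬ (∀ (Nf : ℕ) (reg : QCDRegularisation Nf) (mc : ℕ → ℝ),
        Tendsto (fun k => (reg.mcrit k - mc k) * reg.Zm k / reg.a k) atTop (𝓝 0) →
        reg.HasMassScaling → (reg.scheme 0 0 0).HasAsymptoticScaling →
        (∀ᶠ k in atTop, (-1 : ℝ) < reg.mcrit k) →
        ∀ m : Fin Nf → ℝ, (∀ f, 0 < m f) → ∀ l : ℝ, 1 ≤ l → ∀ Δ : ℝ, 0 < Δ →
          (reg.scheme (fun f => l * m f) 0 0).HasLatticeMassGap Δ →
          ∀ Δ' : ℝ, 0 < Δ' → Δ' < Δ / l → (reg.scheme m 0 0).HasLatticeMassGap Δ') := by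
  intro hD
  obtain ⟨μ₁, hμ₁, hμ₁lt, hnogap⟩ := hsoft (Δ₀ / 4) (by positivity) (μ₀ / 2) (by positivity)
  obtain ⟨g, hg⟩ : ∃ g : ℕ → ℝ, ∀ k, g k = reg.mcrit k - reg.a k * (μ₀ - 2 * μ₁) / reg.Zm k :=
    ⟨_, fun _ => rfl⟩
  -- `mc := g` discharges the pin of the re-pinned regularisation
  have hpin₁ : Tendsto (fun k => (({ reg with mcrit := g } : QCDRegularisation Nf).mcrit k - g k) *
      ({ reg with mcrit := g } : QCDRegularisation Nf).Zm k /
        ({ reg with mcrit := g } : QCDRegularisation Nf).a k) atTop (𝓝 0) := by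
    have e : (fun k => (({ reg with mcrit := g } : QCDRegularisation Nf).mcrit k - g k) *
        ({ reg with mcrit := g } : QCDRegularisation Nf).Zm k /
          ({ reg with mcrit := g } : QCDRegularisation Nf).a k) = fun _ => 0 := by
      funext k
      show (g k - g k) * reg.Zm k / reg.a k = 0
      simp
    rw [e]
    exact tendsto_const_nhds
  have hms₁ : ({ reg with mcrit := g } : QCDRegularisation Nf).HasMassScaling := hms
  have haf₁ :
      (({ reg with mcrit := g } : QCDRegularisation Nf).scheme 0 0 0).HasAsymptoticScaling := haf
  have hbranch₁ : ∀ᶠ k in atTop,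
      (-1 : ℝ) < ({ reg with mcrit := g } : QCDRegularisation Nf).mcrit k := by
    filter_upwards [eventually_branch_shift reg hcrit hres (μ₀ - 2 * μ₁)] with k hk
    show (-1 : ℝ) < g k
    rw [hg k]
    exact hk
  have hmpos : ∀ _f : Fin Nf, (0 : ℝ) < μ₀ - μ₁ := fun _ => by linarith
  have hup : (({ reg with mcrit := g } : QCDRegularisation Nf).scheme
      (fun f : Fin Nf => (2 : ℝ) * (fun _ : Fin Nf => μ₀ - μ₁) f) 0 0).HasLatticeMassGap Δ₀ := by
    refine hasLatticeMassGap_repin_of_mq_eq reg g (fun _ => μ₀) _ (fun f k => ?_) hgap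
    rw [hg k]
    ring
  have hdown := hD Nf ({ reg with mcrit := g } : QCDRegularisation Nf) g hpin₁ hms₁ haf₁ hbranch₁
    (fun _ => μ₀ - μ₁) hmpos 2 (by norm_num) Δ₀ hΔ₀ hup (Δ₀ / 4) (by positivity) (by linarith)
  refine hnogap (hasLatticeMassGap_of_repin_of_mq_eq reg g (fun _ => μ₁) (fun _ => μ₀ - μ₁)
    (fun f k => ?_) hdown)
  rw [hg k]
  ring

end Summit.QuantumFields.QCD.Theorems.RayDescentNegative

end
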